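import Summits.Parity.GeneralizedHardyLittlewood.Theorems.BeyondDiagonalBeatsQuarter.CornerAbel
import HarnessLib

/-!
# Route `PrimeLevelFamEdge`, crux K_A `MomentsBeyondDiagonal` (stmt-Parity-20007), line «petersson_layers» v4, stub `stub_diag`:
# **Abel summation against a product `f·h` with `f` antitone and `h` of BOUNDED VARIATION**

The corner of the `X²`/`Q = 1` chain is summed by parts against the weight `ℓ⁺(e)²·E(αke)` with `E ≥ 0` MONOTONE
(`Corner.sum_abs_prod_sub_le`, `Corner.abs_sum_Ioc_mul_prod_le`, stmt-Parity-20343). For general `Q` the remainders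
`r_ab` of the Bose coefficients (`…DiagBoseMixedStructure.bose_coeff_structure`, p820072) are not monotone but have
controlled variation (`…DiagBoseMixedRemainder.abs_integral_shell_rem_le`, `…DiagBoseMixedTail`). This file supplies the
bounded-variation versions of the two Abel lemmas, and the variation of a weight along an arithmetic ray:

* `sum_abs_prod_sub_le_of_bv` — `f ≥ 0` antitone, `f ≤ F`; `|h| ≤ H` and `Σ|h(e+1)−h(e)| ≤ V` on the range ⇒
  `Σ_{u<e≤w}|f(e)h(e) − f(e+1)h(e+1)| ≤ F(H + V)`;
* `abs_sum_Ioc_mul_prod_le_of_bv` — with `|A(e) − A(u)| ≤ B` on `(u,w]` and `f(w+1) = 0`: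
  `|Σ_{u<e≤w} a(e)f(e)h(e)| ≤ B·F·(H+V)`;
* `sum_abs_sub_le_of_lipschitz_sqrt` — if `|r(y₁) − r(y₂)| ≤ C(y₂−y₁)/√y₁` for `0 < y₁ ≤ y₂ ≤ 1`, then along the ray
  `e ↦ r(c·e)` (`c > 0`, `c·(w+1) ≤ 1`): `Σ_{u<e≤w}|r(c(e+1)) − r(ce)| ≤ 2C√(c(w+1))`.

Def-free; theorems only. Helper `--supports stmt-Parity-20007`; closes nothing; K_A, K_B and the Parity summit are NOT
proved; nothing about Landau–Siegel zeros.

## References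
* E. Kowalski, P. Michel, J. VanderKam, J. reine angew. Math. 526 (2000), Prop. 5.1 p. 18.
  [cite: KowalskiMichelVanderKam2000, Prop. 5.1 — derivation (summation by parts in the corner of the diagonal)]
-/

noncomputable section

open Finset Real

namespace Summit.Parity.GeneralizedHardyLittlewood.Theorems.MomentsBeyondDiagonal.DiagCorner

open Summit.Parity.GeneralizedHardyLittlewood.Theorems.BeyondDiagonalBeatsQuarter.KernelFormXSq
  (sum_Ioc_sub_succ sum_Ioc_mul_eq_abel)

/-- **Total variation of `f·h`, `h` of bounded variation**: for `f ≥ 0` antitone with `f ≤ F`, `|h| ≤ H` on `(u, w+1]`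
and `Σ_{u<e≤w}|h(e+1) − h(e)| ≤ V`: `Σ_{u<e≤w} |f(e)h(e) − f(e+1)h(e+1)| ≤ F(H + V)`. [folklore] -/
theorem sum_abs_prod_sub_le_of_bv {f h : ℕ → ℝ} {u w : ℕ} (huw : u ≤ w) {F H V : ℝ}
    (hf0 : ∀ e, 0 ≤ f e) (hfF : ∀ e, f e ≤ F) (hf : ∀ e, u < e → f (e + 1) ≤ f e)
    (hhH : ∀ e, u < e → e ≤ w + 1 → |h e| ≤ H) (hV : ∑ e ∈ Ioc u w, |h (e + 1) - h e| ≤ V) :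
    ∑ e ∈ Ioc u w, |f e * h e - f (e + 1) * h (e + 1)| ≤ F * (H + V) := by
  have hF : 0 ≤ F := (hf0 0).trans (hfF 0)
  have hH : 0 ≤ H := (abs_nonneg _).trans (hhH (u + 1) (Nat.lt_succ_self u) (by omega))
  have hterm : ∀ e ∈ Ioc u w, |f e * h e - f (e + 1) * h (e + 1)| ≤
      H * (f e - f (e + 1)) + F * |h (e + 1) - h e| := by
    intro e he
    have he' := Finset.mem_Ioc.1 he
    have h1 : f e * h e - f (e + 1) * h (e + 1) =
        (f e - f (e + 1)) * h e + f (e + 1) * (h e - h (e + 1)) := by ring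
    rw [h1]
    have hfe : 0 ≤ f e - f (e + 1) := by linarith [hf e he'.1]
    calc |(f e - f (e + 1)) * h e + f (e + 1) * (h e - h (e + 1))|
        ≤ |(f e - f (e + 1)) * h e| + |f (e + 1) * (h e - h (e + 1))| := abs_add_le _ _
      _ = (f e - f (e + 1)) * |h e| + f (e + 1) * |h (e + 1) - h e| := by
          rw [abs_mul, abs_mul, abs_of_nonneg hfe, abs_of_nonneg (hf0 _), abs_sub_comm (h e)]
      _ ≤ (f e - f (e + 1)) * H + F * |h (e + 1) - h e| := by
          gcongr
          · exact hhH e he'.1 (by omega)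
          · exact hfF _
      _ = H * (f e - f (e + 1)) + F * |h (e + 1) - h e| := by ring
  refine (Finset.sum_le_sum hterm).trans ?_
  rw [Finset.sum_add_distrib, ← Finset.mul_sum, ← Finset.mul_sum, sum_Ioc_sub_succ f huw]
  have h1 : f (u + 1) - f (w + 1) ≤ F := by linarith [hfF (u + 1), hf0 (w + 1)]
  nlinarith [mul_le_mul_of_nonneg_left hV hF, mul_le_mul_of_nonneg_left h1 hH]

/-- **Abel bound against `f·h` vanishing at the right end, `h` of bounded variation.** If `|A(e) − A(u)| ≤ B` for
`u < e ≤ w` (`A(e) = Σ_{k≤e} a(k)`), `f ≥ 0` antitone with `f ≤ F` and `f(w+1) = 0`, `|h| ≤ H` on `(u, w+1]` and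
`Σ_{u<e≤w}|h(e+1)−h(e)| ≤ V`, then `|Σ_{u<e≤w} a(e)f(e)h(e)| ≤ B·F·(H+V)`. [folklore] -/
theorem abs_sum_Ioc_mul_prod_le_of_bv (a : ℕ → ℝ) {f h : ℕ → ℝ} {u w : ℕ} (huw : u ≤ w) {B F H V : ℝ}
    (hB0 : 0 ≤ B) (hB : ∀ e, u < e → e ≤ w → |∑ k ∈ Icc 1 e, a k - ∑ k ∈ Icc 1 u, a k| ≤ B)
    (hf0 : ∀ e, 0 ≤ f e) (hfF : ∀ e, f e ≤ F) (hf : ∀ e, u < e → f (e + 1) ≤ f e) (hfw : f (w + 1) = 0)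
    (hhH : ∀ e, u < e → e ≤ w + 1 → |h e| ≤ H) (hV : ∑ e ∈ Ioc u w, |h (e + 1) - h e| ≤ V) :
    |∑ e ∈ Ioc u w, a e * (f e * h e)| ≤ B * (F * (H + V)) := by
  set φ : ℕ → ℝ := fun e ↦ f e * h e with hφ
  set A : ℕ → ℝ := fun e ↦ ∑ k ∈ Icc 1 e, a k with hAdef
  have habel := sum_Ioc_mul_eq_abel a φ huw
  have hφw : φ (w + 1) = 0 := by simp [hφ, hfw]
  have hcentre : ∑ e ∈ Ioc u w, A u * (φ e - φ (e + 1)) = A u * φ (u + 1) := by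
    rw [← Finset.mul_sum, sum_Ioc_sub_succ φ huw, hφw, sub_zero]
  have hmain : ∑ e ∈ Ioc u w, a e * φ e = ∑ e ∈ Ioc u w, (A e - A u) * (φ e - φ (e + 1)) := by
    rw [habel, hφw, mul_zero, add_zero]
    have : ∑ e ∈ Ioc u w, (A e - A u) * (φ e - φ (e + 1)) =
        ∑ e ∈ Ioc u w, A e * (φ e - φ (e + 1)) - ∑ e ∈ Ioc u w, A u * (φ e - φ (e + 1)) := by
      rw [← Finset.sum_sub_distrib]
      exact Finset.sum_congr rfl fun e _ ↦ by ring
    rw [this, hcentre]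
  rw [hmain]
  calc |∑ e ∈ Ioc u w, (A e - A u) * (φ e - φ (e + 1))|
      ≤ ∑ e ∈ Ioc u w, |(A e - A u) * (φ e - φ (e + 1))| := Finset.abs_sum_le_sum_abs _ _
    _ ≤ ∑ e ∈ Ioc u w, B * |φ e - φ (e + 1)| := by
        refine Finset.sum_le_sum fun e he ↦ ?_
        have he' := Finset.mem_Ioc.1 he
        rw [abs_mul]
        exact mul_le_mul_of_nonneg_right (hB e he'.1 he'.2) (abs_nonneg _)
    _ = B * ∑ e ∈ Ioc u w, |f e * h e - f (e + 1) * h (e + 1)| := by rw [← Finset.mul_sum]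
    _ ≤ B * (F * (H + V)) :=
        mul_le_mul_of_nonneg_left (sum_abs_prod_sub_le_of_bv huw hf0 hfF hf hhH hV) hB0

/-- **Variation along a ray of a weight that is `√`-Lipschitz near `0`.** If `|r(y₁) − r(y₂)| ≤ C(y₂−y₁)/√y₁` for
`0 < y₁ ≤ y₂ ≤ 1`, then for `c > 0` and `c(w+1) ≤ 1`:
`Σ_{u<e≤w} |r(c(e+1)) − r(ce)| ≤ 2C√(c(w+1))` (`c/√(ce) ≤ 2(√(ce) − √(c(e−1)))`, telescoping). [folklore] -/
theorem sum_abs_sub_le_of_lipschitz_sqrt {r : ℝ → ℝ} {C c : ℝ} (hc : 0 < c)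
    (hr : ∀ y₁ y₂ : ℝ, 0 < y₁ → y₁ ≤ y₂ → y₂ ≤ 1 → |r y₁ - r y₂| ≤ C * (y₂ - y₁) / Real.sqrt y₁)
    {u w : ℕ} (huw : u ≤ w) (hw : c * ((w : ℝ) + 1) ≤ 1) :
    ∑ e ∈ Ioc u w, |r (c * ((e : ℝ) + 1)) - r (c * e)| ≤ 2 * C * Real.sqrt (c * ((w : ℝ) + 1)) := by
  have hC0 : 0 ≤ C := by
    -- the hypothesis at `y₁ = c(w+1)/2 < y₂ = c(w+1)` forces `C ≥ 0`
    have hy : 0 < c * ((w : ℝ) + 1) := by positivity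
    have h := hr (c * ((w : ℝ) + 1) / 2) (c * ((w : ℝ) + 1)) (by positivity) (by linarith) hw
    have hpos : 0 < (c * ((w : ℝ) + 1) - c * ((w : ℝ) + 1) / 2) / Real.sqrt (c * ((w : ℝ) + 1) / 2) := by
      apply div_pos (by linarith) (Real.sqrt_pos.2 (by positivity))
    have h' : 0 ≤ C * ((c * ((w : ℝ) + 1) - c * ((w : ℝ) + 1) / 2) / Real.sqrt (c * ((w : ℝ) + 1) / 2)) := by
      rw [← mul_div_assoc]; exact (abs_nonneg _).trans h
    exact nonneg_of_mul_nonneg_left h' hpos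
  -- termwise: `|r(c(e+1)) − r(ce)| ≤ C c/√(ce) ≤ 2C(√(ce) − √(c(e−1)))`
  have hterm : ∀ e ∈ Ioc u w, |r (c * ((e : ℝ) + 1)) - r (c * e)| ≤
      2 * C * (Real.sqrt (c * e) - Real.sqrt (c * ((e : ℝ) - 1))) := by
    intro e he
    have he' := Finset.mem_Ioc.1 he
    have he1 : (1 : ℝ) ≤ e := by exact_mod_cast (show 1 ≤ e by omega)
    have hce : 0 < c * (e : ℝ) := by positivity
    have hce1 : 0 ≤ c * ((e : ℝ) - 1) := by nlinarith
    have hle : c * (e : ℝ) ≤ c * ((e : ℝ) + 1) := by nlinarith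
    have hle' : c * ((e : ℝ) - 1) ≤ c * (e : ℝ) := by nlinarith
    have hle1 : c * ((e : ℝ) + 1) ≤ 1 := by
      have : ((e : ℝ) + 1) ≤ (w : ℝ) + 1 := by exact_mod_cast (show e + 1 ≤ w + 1 by omega)
      nlinarith
    have h := hr (c * e) (c * ((e : ℝ) + 1)) hce hle hle1
    rw [abs_sub_comm] at h
    have hs0 : 0 < Real.sqrt (c * e) := Real.sqrt_pos.2 hce
    have hs1 : 0 ≤ Real.sqrt (c * ((e : ℝ) - 1)) := Real.sqrt_nonneg _
    set D : ℝ := Real.sqrt (c * e) - Real.sqrt (c * ((e : ℝ) - 1)) with hD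
    have hD0 : 0 ≤ D := by rw [hD]; linarith [Real.sqrt_le_sqrt hle']
    have hsq : D * (Real.sqrt (c * e) + Real.sqrt (c * ((e : ℝ) - 1))) = c := by
      rw [hD, mul_comm, ← sq_sub_sq, Real.sq_sqrt hce.le, Real.sq_sqrt hce1]; ring
    -- `c = D·(√(ce)+√(c(e−1))) ≤ D·2√(ce)`
    have hkey : c ≤ D * (2 * Real.sqrt (c * e)) := by
      calc c = D * (Real.sqrt (c * e) + Real.sqrt (c * ((e : ℝ) - 1))) := hsq.symm
        _ ≤ D * (2 * Real.sqrt (c * e)) := by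
            apply mul_le_mul_of_nonneg_left _ hD0
            linarith [Real.sqrt_le_sqrt hle']
    have hfrac : C * (c * ((e : ℝ) + 1) - c * e) / Real.sqrt (c * e) ≤ 2 * C * D := by
      have hnum : c * ((e : ℝ) + 1) - c * e = c := by ring
      rw [hnum, div_le_iff₀ hs0]
      nlinarith [hkey, hC0]
    exact h.trans hfrac
  refine (Finset.sum_le_sum hterm).trans ?_
  rw [← Finset.mul_sum]
  have htel : ∑ e ∈ Ioc u w, (Real.sqrt (c * e) - Real.sqrt (c * ((e : ℝ) - 1))) =
      Real.sqrt (c * w) - Real.sqrt (c * u) := by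
    have h := sum_Ioc_sub_succ (fun e : ℕ ↦ -Real.sqrt (c * ((e : ℝ) - 1))) huw
    simp only [Nat.cast_add, Nat.cast_one, add_sub_cancel_right] at h
    have h' : ∀ e ∈ Ioc u w, Real.sqrt (c * e) - Real.sqrt (c * ((e : ℝ) - 1)) =
        -Real.sqrt (c * ((e : ℝ) - 1)) - -Real.sqrt (c * e) := fun e _ ↦ by ring
    rw [Finset.sum_congr rfl h', h]
    ring
  rw [htel]
  have hu0 : 0 ≤ Real.sqrt (c * u) := Real.sqrt_nonneg _
  have hw1 : Real.sqrt (c * w) ≤ Real.sqrt (c * ((w : ℝ) + 1)) := Real.sqrt_le_sqrt (by nlinarith)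
  nlinarith [Real.sqrt_nonneg (c * ((w : ℝ) + 1))]

end Summit.Parity.GeneralizedHardyLittlewood.Theorems.MomentsBeyondDiagonal.DiagCorner

end
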